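import Literature.AlgebraicGeometry.GroupSchemes.GroupSchemeActionStabilizer
import Literature.AlgebraicGeometry.Morphisms.ContainmentLocusFiniteFlat
import Mathlib.AlgebraicGeometry.Morphisms.Finite
import HarnessLib

/-!
# The fixed locus of a section under a finite flat group-scheme action is a closed subscheme of the base

Topic `Literature/AlgebraicGeometry/GroupSchemes`; theorems only (no definition, no named fact, no instance, no notation,
no `sorry`).  Cell hodgecm-mathlib, F-DAG (h6) (i) (B-plan1 (g15) 05:17:19Z), paired with ★
`GroupSchemes/GroupSchemeActionStabilizer` (the stabilizer OBJECT `Stab(x) = G ×_{ψ_x, X, x} S` of a section `x`, its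
inclusion `stabι`, `stabLift`; [MumfordFogartyKirwan1994] Ch. 0 §1 Def. 0.4) and B-typ03 (g16)'s (O2)
`GroupSchemeActionStabilizerBaseChange` (its base change); the LOCI are ★ `Morphisms/EqualizerLocusClosed`,
★ `Morphisms/ContainmentLocusClosed`, ★ `Morphisms/ContainmentLocusFiniteFlat` — exactly as ★
`GroupSchemes/KernelLocusFiniteFlat` does for `Ker φ = Eq(φ, 1)`.  HC_CM is proved only modulo the 7 printed citations until
rung 0 closes; nothing here is about HC.

For an `S`-group scheme `G` acting on an `S`-scheme `X` (`[GrpObj G] [ModObj G X]` in `Over S`) and a section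
`x : 𝟙_ ⟶ X`, «`G` FIXES `x`» means that the orbit map `ψ_x : G ⟶ X`, `g ↦ g · x` (★ `Stabilizer.orbitMap`) equals the constant
map `G → S → X` through `x`, i.e. `Stab(x) = G`:

* §1 **`orbitMap_eq_iff_isIso_stabι`** (`ψ_x = const_x ↔ Stab(x) ⟶ G` is an isomorphism), `isFinite_stab_hom`, `isAffineHom_stab_hom`
  (`Stab(x) → S` finite / affine for `G → S` finite / affine and `X → S` separated);
* §2 **`stabι_ker_eq_equalizer_ι_ker`** — `Stab(x)` and `Eq(ψ_x, const_x)` cut the SAME ideal sheaf of `G` (same functor of points,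
  `exists_comp_stabι_left_eq_iff`), hence **`pullback_map_orbitMap_eq_iff_stabι_ker_le`**: «`G_T` fixes `x_T`» (`(ψ_x)_T = (const_x)_T`)
  ⟺ «`G_T ⊆ Stab(x)_T`» (`𝓘_{Stab(x)} ≤ (G ×_S T ⟶ G).ker`); `orbitMap_eq_iff_stabι_ker_eq_bot`;
* §3 for `G → S` FINITE AND FLAT over a locally noetherian `S` (or affine with finite projective charts) and `X → S` separated:
  **`exists_idealSheafData_iff_stabι_ker_le_of_isFinite_of_flat`** — ONE closed subscheme `V(E) ⊆ S`, THE FIXED LOCUS OF `x`, with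
  `E ≤ b.ker ↔ 𝓘_{Stab(x)} ≤ (G ×_S T ⟶ G).ker ↔ (ψ_x)_T = (const_x)_T` and the factorisation form: a `T`-point `b` of `S` factors
  through the fixed locus iff `G_T` fixes `x_T`.

## References
* [MumfordFogartyKirwan1994] D. Mumford, J. Fogarty, F. Kirwan, *Geometric Invariant Theory*, 3rd ed. (1994), Ch. 0 §1, Def. 0.4
  (p. 3) (the stabilizer `S(x)` as a fibre product), Ch. 6 §3 Prop. 6.16 (p. 126) (closed conditions on the base).
* [GortzWedhorn2020] U. Görtz, T. Wedhorn, *Algebraic Geometry I: Schemes*, 2nd ed. (2020): Definition/Proposition 9.7 (ii)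
  (equalisers into separated schemes are closed), Definition 12.18 and Proposition 12.19 (pp. 331–332) (finite locally free
  morphisms).
-/

noncomputable section

-- `TopCat.Presheaf`/`Scheme.Modules` are not reducible (as in Mathlib's `AlgebraicGeometry/Modules`).
set_option backward.isDefEq.respectTransparency false

open CategoryTheory CategoryTheory.Limits AlgebraicGeometry MonoidalCategory CartesianMonoidalCategory

universe u

namespace Literature.AlgebraicGeometry.GroupSchemes

open Stabilizer Literature.AlgebraicGeometry.Morphisms
open scoped MonObj

/-! ## §1 `G` fixes `x` iff `Stab(x) ⟶ G` is an isomorphism; `Stab(x) → S` finite -/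

section General

variable {S : Scheme.{u}} (G : Over S) {X : Over S} [GrpObj G] [ModObj G X] (x : 𝟙_ (Over S) ⟶ X)

omit [GrpObj G] [ModObj G X] in
/-- The constant map `G → S → X` through the section `x`, composed with any `h : W ⟶ G`, is the point `x` over `W`.
[cite: MumfordFogartyKirwan1994, Ch. 0 §1, Def. 0.4 (p. 3)] -/
theorem comp_toUnit_comp_section {W : Over S} (h : W ⟶ G) : h ≫ (toUnit G ≫ x) = toUnit W ≫ x := by
  rw [← Category.assoc, toUnit_unique (h ≫ toUnit G) (toUnit W)]

/-- **`G` fixes `x` (`ψ_x = const_x`) iff the stabilizer inclusion `Stab(x) ⟶ G` is an isomorphism** (then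
`stabLift (𝟙 G)` is its inverse; conversely `ψ_x = (ι⁻¹ ≫ ι) ≫ ψ_x = ι⁻¹ ≫ x_{Stab(x)} = const_x`).
[cite: MumfordFogartyKirwan1994, Ch. 0 §1, Def. 0.4 (p. 3)] -/
theorem orbitMap_eq_iff_isIso_stabι : orbitMap G x = toUnit G ≫ x ↔ IsIso (stabι G x) := by
  constructor
  · intro hfix
    have hg : (𝟙 G) • (toUnit G ≫ x) = toUnit G ≫ x := by
      rw [← comp_orbitMap, Category.id_comp, hfix]
    refine ⟨⟨stabLift (𝟙 G) hg, ?_, stabLift_ι _ _⟩⟩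
    exact stab_hom_ext (by rw [Category.assoc, stabLift_ι, Category.id_comp, Category.comp_id])
  · intro h
    rw [← Category.id_comp (orbitMap G x), ← IsIso.inv_hom_id (stabι G x), Category.assoc, stabι_comp_orbitMap,
      ← Category.assoc, toUnit_unique (inv (stabι G x) ≫ toUnit _) (toUnit G)]

/-- **`Stab(x) → S` is finite** for `G → S` finite and `X → S` separated (`Stab(x) ⟶ G` is then a closed immersion, ★
`isClosedImmersion_stabι_left_of_isSeparated`). [cite: MumfordFogartyKirwan1994, Ch. 0 §1, Def. 0.4 (p. 3)] -/
theorem isFinite_stab_hom [IsFinite G.hom] [IsSeparated X.hom] : IsFinite (stab G x).hom := by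
  haveI := isClosedImmersion_stabι_left_of_isSeparated G x
  rw [← Over.w (stabι G x)]
  infer_instance

/-- `Stab(x) → S` is affine for `G → S` affine and `X → S` separated. [cite: MumfordFogartyKirwan1994, Ch. 0 §1, Def. 0.4 (p. 3)] -/
theorem isAffineHom_stab_hom [IsAffineHom G.hom] [IsSeparated X.hom] : IsAffineHom (stab G x).hom := by
  haveI := isClosedImmersion_stabι_left_of_isSeparated G x
  rw [← Over.w (stabι G x)]
  infer_instance

end General

/-! ## §2 `Stab(x)` and `Eq(ψ_x, const_x)` cut the same ideal sheaf; «`G_T` fixes `x_T`» ⟺ «`G_T ⊆ Stab(x)_T`» -/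

section Ideal

variable {S : Scheme.{u}} (G : Over S) {X : Over S} [GrpObj G] [ModObj G X] (x : 𝟙_ (Over S) ⟶ X)

/-- A morphism of schemes `h : W ⟶ G` factors through `Stab(x)` iff `h ≫ ψ_x = h ≫ const_x` (as `S`-morphisms, `W` over `S` via
`h ≫ (G → S)`): the functor of points of the stabilizer, in the equaliser form. [cite: MumfordFogartyKirwan1994, Ch. 0 §1, Def. 0.4 (p. 3)] -/
theorem exists_comp_stabι_left_eq_iff {W : Scheme.{u}} (h : W ⟶ G.left) :
    (∃ k : W ⟶ (stab G x).left, k ≫ (stabι G x).left = h) ↔ h ≫ (orbitMap G x).left = h ≫ (toUnit G ≫ x).left := by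
  rw [← exists_comp_equalizer_ι_eq_iff]
  let W' : Over S := Over.mk (h ≫ G.hom)
  let h' : W' ⟶ G := Over.homMk h rfl
  constructor
  · rintro ⟨k, hk⟩
    have hkφ : h ≫ (orbitMap G x).left = h ≫ (toUnit G ≫ x).left := by
      have e1 : (h' ≫ orbitMap G x).left = (h' ≫ (toUnit G ≫ x)).left := by
        rw [comp_toUnit_comp_section]
        let k' : W' ⟶ stab G x := Over.homMk k (by
          change k ≫ (stab G x).hom = h ≫ G.hom
          rw [← Over.w (stabι G x), ← Category.assoc, hk])
        have hk' : k' ≫ stabι G x = h' := Over.OverMorphism.ext hk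
        rw [← hk', Category.assoc, stabι_comp_orbitMap, ← Category.assoc, toUnit_unique (k' ≫ toUnit _) (toUnit W')]
      exact e1
    exact (exists_comp_equalizer_ι_eq_iff (orbitMap G x) (toUnit G ≫ x) h).2 hkφ
  · intro hex
    have hφ1 : h ≫ (orbitMap G x).left = h ≫ (toUnit G ≫ x).left :=
      (exists_comp_equalizer_ι_eq_iff (orbitMap G x) (toUnit G ≫ x) h).1 hex
    have hg : h' • (toUnit W' ≫ x) = toUnit W' ≫ x := by
      have : h' ≫ orbitMap G x = h' ≫ (toUnit G ≫ x) := Over.OverMorphism.ext hφ1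
      rw [← comp_orbitMap, this, comp_toUnit_comp_section]
    exact ⟨(stabLift h' hg).left, congrArg Over.Hom.left (stabLift_ι h' hg)⟩

/-- **`Stab(x)` and `Eq(ψ_x, const_x)` have the same ideal sheaf in `G`** (`X → S` separated, so both are closed subschemes of `G`
with the same functor of points). [cite: MumfordFogartyKirwan1994, Ch. 0 §1, Def. 0.4 (p. 3)]
[cite: GortzWedhorn2020, Definition/Proposition 9.7 (ii)] -/
theorem stabι_ker_eq_equalizer_ι_ker [IsSeparated X.hom] :
    (stabι G x).left.ker = (equalizer.ι (orbitMap G x) (toUnit G ≫ x)).left.ker := by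
  haveI := isClosedImmersion_stabι_left_of_isSeparated G x
  refine idealSheafData_eq_of_forall_le_ker_iff fun W h => ?_
  rw [← comp_eq_comp_iff_ker_equalizer_ι_le, ← exists_comp_stabι_left_eq_iff]
  constructor
  · intro hle
    exact ⟨IsClosedImmersion.lift (stabι G x).left h hle, IsClosedImmersion.lift_fac _ _ _⟩
  · rintro ⟨k, rfl⟩
    exact Scheme.Hom.le_ker_comp _ _

/-- **«`G_T` fixes `x_T`» ⟺ «`G_T ⊆ Stab(x)_T`»**: the base changes of the orbit map `ψ_x` and of the constant map `const_x`
along `b : T ⟶ S` agree iff the projection `G ×_S T ⟶ G` kills the ideal sheaf of `Stab(x)`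
(★ `EqualizerLocusClosed.pullback_map_eq_iff_ker_equalizer_ι_le` + §2). [cite: MumfordFogartyKirwan1994, Ch. 0 §1, Def. 0.4 (p. 3)]
[cite: GortzWedhorn2020, Definition/Proposition 9.7 (ii)] -/
theorem pullback_map_orbitMap_eq_iff_stabι_ker_le [IsSeparated X.hom] {T : Scheme.{u}} (b : T ⟶ S) :
    (Over.pullback b).map (orbitMap G x) = (Over.pullback b).map (toUnit G ≫ x) ↔
      (stabι G x).left.ker ≤ (pullback.fst G.hom b).ker := by
  rw [stabι_ker_eq_equalizer_ι_ker, pullback_map_eq_iff_ker_equalizer_ι_le]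

/-- Globally: `G` fixes `x` iff the ideal sheaf of the closed subscheme `Stab(x) ⊆ G` vanishes.
[cite: MumfordFogartyKirwan1994, Ch. 0 §1, Def. 0.4 (p. 3)] -/
theorem orbitMap_eq_iff_stabι_ker_eq_bot [IsSeparated X.hom] :
    orbitMap G x = toUnit G ≫ x ↔ (stabι G x).left.ker = ⊥ := by
  haveI := isClosedImmersion_stabι_left_of_isSeparated G x
  rw [orbitMap_eq_iff_isIso_stabι, ← IsClosedImmersion.isIso_iff_ker_eq_bot]
  constructor
  · intro h
    infer_instance
  · intro h
    haveI : IsIso ((Over.forget S).map (stabι G x)) := h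
    exact isIso_of_reflects_iso (stabι G x) (Over.forget S)

end Ideal

/-! ## §3 The fixed locus of `x`, for a finite flat `G` -/

section Locus

variable {S : Scheme.{u}} (G : Over S) {X : Over S} [GrpObj G] [ModObj G X] (x : 𝟙_ (Over S) ⟶ X)

/-- **THE FIXED LOCUS OF A SECTION IS A CLOSED SUBSCHEME OF THE BASE**, for `G → S` finite and flat over a locally noetherian `S`
acting on a separated `X/S`: one ideal sheaf `E` on `S` with `E ≤ b.ker ↔ 𝓘_{Stab(x)} ≤ (G ×_S T ⟶ G).ker ↔ (ψ_x)_T = (const_x)_T`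
(«`G_T` fixes `x_T`»), and a `T`-point `b` of `S` factors through `V(E)` iff `G_T` fixes `x_T`
(★ `ContainmentLocusFiniteFlat` at `Z := Stab(x)`). [cite: MumfordFogartyKirwan1994, Ch. 6 §3 Prop. 6.16 (p. 126)]
[cite: GortzWedhorn2020, Definition 12.18 and Proposition 12.19 (pp. 331–332)] -/
theorem exists_idealSheafData_iff_stabι_ker_le_of_isFinite_of_flat [IsFinite G.hom] [Flat G.hom] [IsLocallyNoetherian S]
    [IsSeparated X.hom] :
    ∃ E : S.IdealSheafData, ∀ ⦃T : Scheme.{u}⦄ (b : T ⟶ S),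
      (E ≤ b.ker ↔ (stabι G x).left.ker ≤ (pullback.fst G.hom b).ker) ∧
      (E ≤ b.ker ↔ (Over.pullback b).map (orbitMap G x) = (Over.pullback b).map (toUnit G ≫ x)) ∧
      ((∃ b' : T ⟶ E.subscheme, b' ≫ E.subschemeι = b) ↔
        (Over.pullback b).map (orbitMap G x) = (Over.pullback b).map (toUnit G ≫ x)) := by
  obtain ⟨E, hE⟩ := exists_idealSheafData_le_ker_iff_le_ker_fst_of_finite_projective_app G.hom (stabι G x).left.ker
    (finite_projective_app_of_isFinite_of_flat G.hom)
  have hE' : ∀ ⦃T : Scheme.{u}⦄ (b : T ⟶ S),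
      E ≤ b.ker ↔ (equalizer.ι (orbitMap G x) (toUnit G ≫ x)).left.ker ≤ (pullback.fst G.hom b).ker := fun T b => by
    rw [← stabι_ker_eq_equalizer_ι_ker]; exact hE b
  exact ⟨E, fun T b => ⟨hE b, le_ker_iff_pullback_map_eq_of_containment _ _ E hE' b,
    exists_comp_subschemeι_eq_iff_pullback_map_eq_of_containment _ _ E hE' b⟩⟩

/-- The same for `G → S` affine with finite projective affine charts (any base). [cite: MumfordFogartyKirwan1994, Ch. 6 §3 Prop. 6.16 (p. 126)]
[cite: GortzWedhorn2020, Definition 12.18 and Proposition 12.19 (pp. 331–332)] -/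
theorem exists_idealSheafData_iff_stabι_ker_le_of_finite_projective_app [IsAffineHom G.hom]
    (hp : ∀ s : S, ∃ W : S.Opens, s ∈ W ∧ IsAffineOpen W ∧
      letI := (G.hom.app W).hom.toAlgebra
      Module.Finite Γ(S, W) Γ(G.left, G.hom ⁻¹ᵁ W) ∧ Module.Projective Γ(S, W) Γ(G.left, G.hom ⁻¹ᵁ W))
    [IsSeparated X.hom] :
    ∃ E : S.IdealSheafData, ∀ ⦃T : Scheme.{u}⦄ (b : T ⟶ S),
      (E ≤ b.ker ↔ (stabι G x).left.ker ≤ (pullback.fst G.hom b).ker) ∧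
      (E ≤ b.ker ↔ (Over.pullback b).map (orbitMap G x) = (Over.pullback b).map (toUnit G ≫ x)) ∧
      ((∃ b' : T ⟶ E.subscheme, b' ≫ E.subschemeι = b) ↔
        (Over.pullback b).map (orbitMap G x) = (Over.pullback b).map (toUnit G ≫ x)) := by
  obtain ⟨E, hE⟩ := exists_idealSheafData_le_ker_iff_le_ker_fst_of_finite_projective_app G.hom (stabι G x).left.ker hp
  have hE' : ∀ ⦃T : Scheme.{u}⦄ (b : T ⟶ S),
      E ≤ b.ker ↔ (equalizer.ι (orbitMap G x) (toUnit G ≫ x)).left.ker ≤ (pullback.fst G.hom b).ker := fun T b => by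
    rw [← stabι_ker_eq_equalizer_ι_ker]; exact hE b
  exact ⟨E, fun T b => ⟨hE b, le_ker_iff_pullback_map_eq_of_containment _ _ E hE' b,
    exists_comp_subschemeι_eq_iff_pullback_map_eq_of_containment _ _ E hE' b⟩⟩

end Locus

end Literature.AlgebraicGeometry.GroupSchemes

end
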